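import Summits.CriticalPhenomena.PercolationContinuityZ3.Theorems.PercNearOneGluingNoHeavyQuantLightTwoBlobFlow
import Summits.CriticalPhenomena.PercolationContinuityZ3.Theorems.PercNearOneGluingNoHeavyQuantLightTwoBlobPolyCoef
import Summits.CriticalPhenomena.PercolationContinuityZ3.Theorems.PercNearOneGluingNoHeavyQuantLightTwoBlobPolyB
import HarnessLib

/-!
# QUANT lane R8, T-DEC: the light two-blob law, sub-cases "a low" / "b low" — part 3b: the TOP INEQUALITY in the six cells of sub-case "b low" (B1–B6)

builds on p205010 (kernel theorem, internal audit signed; external expert review pending)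

Support file (`--supports stmt-CriticalPhenomena-4575`), QUANT lane typer seat prim-quant-stmt (gen 23), rung R8 of
`run/shared/lean/prim/quant/LADDER.md`.  Theorems only, standard axioms, no sorries.

With `κ = (γ − x²)/(1 − x)` and `T = bκ + ag`, sub-case "b low" is `2b < T` (then `b < a`).  Certificate (I\*) ships `b ↦ a+b` at its
minimal credit gate and atom `0 ↦ a` to capacity `F = (1−γ)g(a−T)/T` (when `T < a`; else `F = 0`), the rest `↦ a+b`; the mid `a` is then
exactly loaded and the one remaining numerical fact is the top inequality of `LawDec.twoBlob_decAtT_of_lowFlow` (`…QuantLightTwoBlobFlow`):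
`usage(b,a+b)·γ(1−g) + usage(0,a+b)·((1−γ)(1−g) − F) ≤ γg`.  Lemmas `top_B1` … `top_B6`, one per cell — (b,a+b) light/heavy
× (0,a+b) light/heavy (a heavy (b,a+b) forces a heavy (0,a+b)) × (`T < a` | `a ≤ T`) — rewrite the usage rates in closed form
(`usage_eq_light'/heavy'`, `usage0_eq_light/heavy`), clear the positive denominators and conclude by the polynomial certificates
`LightTwoBlobCert.poly_B1 … poly_B6` of `…QuantLightTwoBlobPolyCoef` / `…PolyB`.

[this work]; DEC rules ARCH-TREES-G49 §2.2 / DEC-TAMP-G50 §3.1, flow normal form `…QuantLawDecFlows` (this lane).  The gluing rows served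
[cite: KozmaNitzan2024, Conjecture 3 (p. 15)]; product measure [cite: Grimmett1999, §1.3 p. 10].
-/

noncomputable section

namespace Summit.CriticalPhenomena.PercolationContinuityZ3.Theorems

namespace Quant

open Finset

/-- the two-blob law `(1−u)(1−v)δ₀ + u(1−v)δ_a + (1−u)vδ_b + uvδ_{a+b}` evaluated at `h` (as in `…QuantBlobDecTwoLawParts`) -/
local notation3 "LAW2[" a ", " u ", " b ", " v ", " h "]" =>
  (1 - (u : ℝ)) * (1 - (v : ℝ)) * (if (h : ℕ) = 0 then (1 : ℝ) else 0)
    + (u : ℝ) * (1 - (v : ℝ)) * (if (h : ℕ) = (a : ℕ) then (1 : ℝ) else 0)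
    + (1 - (u : ℝ)) * (v : ℝ) * (if (h : ℕ) = (b : ℕ) then (1 : ℝ) else 0)
    + (u : ℝ) * (v : ℝ) * (if (h : ℕ) = (a : ℕ) + (b : ℕ) then (1 : ℝ) else 0)

namespace LawDec

/-- **top inequality, cell B1** (c<a, light, light). [this work] -/
theorem top_B1 (x κ g : ℝ) (a b j'' : ℕ) (hx0 : 0 < x) (hx1 : x < 1) (hk0 : 0 < κ) (hkx : κ < x) (hxg : x ≤ g)
    (hg1 : g ≤ 1) (ha : 1 ≤ a) (hb : 1 ≤ b) (hj : a + b ≤ j'') (h2b : 2 * (b : ℝ) < (b : ℝ) * κ + (a : ℝ) * g)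
    (hTa : ((b : ℝ) * κ + (a : ℝ) * g) < (a : ℝ)) (hL1 : ((b : ℝ) * κ + (a : ℝ) * g) - 2 * (b : ℝ) ≤ x * (((b + a : ℕ) : ℝ) - (b : ℝ))) (hL0 : ((b : ℝ) * κ + (a : ℝ) * g) ≤ x * ((b + a : ℕ) : ℝ)) :
    usage x ((b : ℝ) * κ + (a : ℝ) * g) j'' b (b + a) * ((x ^ 2 + (1 - x) * κ) * (1 - g))
      + usage x ((b : ℝ) * κ + (a : ℝ) * g) j'' 0 (b + a) * ((1 - (x ^ 2 + (1 - x) * κ)) * (1 - g) - (1 - (x ^ 2 + (1 - x) * κ)) * g * ((a : ℝ) - ((b : ℝ) * κ + (a : ℝ) * g)) / ((b : ℝ) * κ + (a : ℝ) * g))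
      ≤ (x ^ 2 + (1 - x) * κ) * g := by
  have ha0 : (0 : ℝ) < (a : ℝ) := by exact_mod_cast Nat.lt_of_lt_of_le Nat.zero_lt_one ha
  have hb0 : (0 : ℝ) < (b : ℝ) := by exact_mod_cast Nat.lt_of_lt_of_le Nat.zero_lt_one hb
  have hg0 : 0 < g := lt_of_lt_of_le hx0 hxg
  have hgam : 0 < x ^ 2 + (1 - x) * κ := by nlinarith [mul_pos (sub_pos.2 hx1) hk0, pow_pos hx0 2]
  have hgam1 : x ^ 2 + (1 - x) * κ < 1 := by nlinarith [mul_lt_mul_of_pos_left hkx (sub_pos.2 hx1)]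
  have hT0 : 0 < (b : ℝ) * κ + (a : ℝ) * g := by nlinarith [mul_pos hb0 hk0, mul_pos ha0 hg0]
  have hsT : (b : ℝ) * κ + (a : ℝ) * g < (b : ℝ) + (a : ℝ) := by
    nlinarith [mul_pos hb0 (sub_pos.2 (hkx.trans hx1)), mul_nonneg ha0.le (sub_nonneg.2 hg1)]
  have hbaj : b + a ≤ j'' := by omega
  have hL1n : (b : ℝ) * κ + (a : ℝ) * g - 2 * (b : ℝ) ≤ x * (a : ℝ) := by have h' := hL1; push_cast at h'; linarith
  have hL0n : (b : ℝ) * κ + (a : ℝ) * g ≤ x * ((a : ℝ) + (b : ℝ)) := by have h' := hL0; push_cast at h'; linarith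
  rw [usage_eq_light' x _ j'' b (b + a) hx0 hx1 hbaj h2b (by push_cast; linarith) hL1,
    usage0_eq_light x _ j'' (b + a) hx0 hx1 hbaj hT0 (by push_cast; linarith) hL0]
  push_cast
  have hd1 : (0:ℝ) < (1 - x) * ((1 - x) * (b : ℝ) + (1 + x) * ((b : ℝ) + (a : ℝ)) - ((b : ℝ) * κ + (a : ℝ) * g)) := by
    apply mul_pos (sub_pos.2 hx1); nlinarith [mul_nonneg hx0.le (by linarith : (0:ℝ) ≤ (b : ℝ) + (a : ℝ))]
  have hd0 : (0:ℝ) < (1 - x) * ((1 + x) * ((b : ℝ) + (a : ℝ)) - ((b : ℝ) * κ + (a : ℝ) * g)) := by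
    apply mul_pos (sub_pos.2 hx1); nlinarith [mul_nonneg hx0.le (by linarith : (0:ℝ) ≤ (b : ℝ) + (a : ℝ))]
  have hn1 : (0:ℝ) ≤ x ^ 2 * (a : ℝ) + (1 - x) * ((b : ℝ) * κ + (a : ℝ) * g - 2 * (b : ℝ)) := by
    nlinarith [mul_nonneg (pow_nonneg hx0.le 2) ha0.le, mul_nonneg (sub_nonneg.2 hx1.le) (sub_nonneg.2 h2b.le)]
  have key := LightTwoBlobCert.poly_B1 x κ g a b ha0.le hb0.le (by linarith) (by linarith) (by linarith [hgam.le]) (by linarith) (by linarith) (by linarith) hk0.le hx0.le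
  rw [div_mul_eq_mul_div, sub_div' hT0.ne', div_mul_div_comm, div_add_div _ _ hd1.ne' (mul_ne_zero hd0.ne' hT0.ne'),
    div_le_iff₀ (mul_pos hd1 (mul_pos hd0 hT0))]
  linarith [mul_nonneg (sub_nonneg.2 hx1.le) (mul_nonneg ha0.le (key))]

/-- **top inequality, cell B2** (c<a, light, heavy). [this work] -/
theorem top_B2 (x κ g : ℝ) (a b j'' : ℕ) (hx0 : 0 < x) (hx1 : x < 1) (hk0 : 0 < κ) (hkx : κ < x) (hxg : x ≤ g)
    (hg1 : g ≤ 1) (ha : 1 ≤ a) (hb : 1 ≤ b) (hj : a + b ≤ j'') (h2b : 2 * (b : ℝ) < (b : ℝ) * κ + (a : ℝ) * g)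
    (hTa : ((b : ℝ) * κ + (a : ℝ) * g) < (a : ℝ)) (hL1 : ((b : ℝ) * κ + (a : ℝ) * g) - 2 * (b : ℝ) ≤ x * (((b + a : ℕ) : ℝ) - (b : ℝ))) (hH0 : x * ((b + a : ℕ) : ℝ) ≤ ((b : ℝ) * κ + (a : ℝ) * g)) :
    usage x ((b : ℝ) * κ + (a : ℝ) * g) j'' b (b + a) * ((x ^ 2 + (1 - x) * κ) * (1 - g))
      + usage x ((b : ℝ) * κ + (a : ℝ) * g) j'' 0 (b + a) * ((1 - (x ^ 2 + (1 - x) * κ)) * (1 - g) - (1 - (x ^ 2 + (1 - x) * κ)) * g * ((a : ℝ) - ((b : ℝ) * κ + (a : ℝ) * g)) / ((b : ℝ) * κ + (a : ℝ) * g))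
      ≤ (x ^ 2 + (1 - x) * κ) * g := by
  have ha0 : (0 : ℝ) < (a : ℝ) := by exact_mod_cast Nat.lt_of_lt_of_le Nat.zero_lt_one ha
  have hb0 : (0 : ℝ) < (b : ℝ) := by exact_mod_cast Nat.lt_of_lt_of_le Nat.zero_lt_one hb
  have hg0 : 0 < g := lt_of_lt_of_le hx0 hxg
  have hgam : 0 < x ^ 2 + (1 - x) * κ := by nlinarith [mul_pos (sub_pos.2 hx1) hk0, pow_pos hx0 2]
  have hgam1 : x ^ 2 + (1 - x) * κ < 1 := by nlinarith [mul_lt_mul_of_pos_left hkx (sub_pos.2 hx1)]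
  have hT0 : 0 < (b : ℝ) * κ + (a : ℝ) * g := by nlinarith [mul_pos hb0 hk0, mul_pos ha0 hg0]
  have hsT : (b : ℝ) * κ + (a : ℝ) * g < (b : ℝ) + (a : ℝ) := by
    nlinarith [mul_pos hb0 (sub_pos.2 (hkx.trans hx1)), mul_nonneg ha0.le (sub_nonneg.2 hg1)]
  have hbaj : b + a ≤ j'' := by omega
  have hL1n : (b : ℝ) * κ + (a : ℝ) * g - 2 * (b : ℝ) ≤ x * (a : ℝ) := by have h' := hL1; push_cast at h'; linarith
  have hH0n : x * ((a : ℝ) + (b : ℝ)) ≤ (b : ℝ) * κ + (a : ℝ) * g := by have h' := hH0; push_cast at h'; linarith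
  rw [usage_eq_light' x _ j'' b (b + a) hx0 hx1 hbaj h2b (by push_cast; linarith) hL1,
    usage0_eq_heavy x _ j'' (b + a) hx0 hx1 hbaj hT0 (by push_cast; linarith) hH0]
  push_cast
  have hd1 : (0:ℝ) < (1 - x) * ((1 - x) * (b : ℝ) + (1 + x) * ((b : ℝ) + (a : ℝ)) - ((b : ℝ) * κ + (a : ℝ) * g)) := by
    apply mul_pos (sub_pos.2 hx1); nlinarith [mul_nonneg hx0.le (by linarith : (0:ℝ) ≤ (b : ℝ) + (a : ℝ))]
  have hd0 : (0:ℝ) < ((b : ℝ) + (a : ℝ)) - ((b : ℝ) * κ + (a : ℝ) * g) := by linarith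
  have hn1 : (0:ℝ) ≤ x ^ 2 * (a : ℝ) + (1 - x) * ((b : ℝ) * κ + (a : ℝ) * g - 2 * (b : ℝ)) := by
    nlinarith [mul_nonneg (pow_nonneg hx0.le 2) ha0.le, mul_nonneg (sub_nonneg.2 hx1.le) (sub_nonneg.2 h2b.le)]
  have key := LightTwoBlobCert.poly_B2 x κ g a b ha0.le hb0.le (by linarith) (by linarith) (by linarith [hgam.le]) (by linarith) (by linarith) (by linarith) hx0.le
  rw [div_mul_eq_mul_div, sub_div' hT0.ne', div_mul_div_comm, div_add_div _ _ hd1.ne' (mul_ne_zero hd0.ne' hT0.ne'),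
    div_le_iff₀ (mul_pos hd1 (mul_pos hd0 hT0))]
  linarith [mul_nonneg hT0.le (key)]

/-- **top inequality, cell B3** (c<a, heavy, heavy). [this work] -/
theorem top_B3 (x κ g : ℝ) (a b j'' : ℕ) (hx0 : 0 < x) (hx1 : x < 1) (hk0 : 0 < κ) (hkx : κ < x) (hxg : x ≤ g)
    (hg1 : g ≤ 1) (ha : 1 ≤ a) (hb : 1 ≤ b) (hj : a + b ≤ j'') (h2b : 2 * (b : ℝ) < (b : ℝ) * κ + (a : ℝ) * g)
    (hTa : ((b : ℝ) * κ + (a : ℝ) * g) < (a : ℝ)) (hH1 : x * (((b + a : ℕ) : ℝ) - (b : ℝ)) ≤ ((b : ℝ) * κ + (a : ℝ) * g) - 2 * (b : ℝ)) (hH0 : x * ((b + a : ℕ) : ℝ) ≤ ((b : ℝ) * κ + (a : ℝ) * g)) :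
    usage x ((b : ℝ) * κ + (a : ℝ) * g) j'' b (b + a) * ((x ^ 2 + (1 - x) * κ) * (1 - g))
      + usage x ((b : ℝ) * κ + (a : ℝ) * g) j'' 0 (b + a) * ((1 - (x ^ 2 + (1 - x) * κ)) * (1 - g) - (1 - (x ^ 2 + (1 - x) * κ)) * g * ((a : ℝ) - ((b : ℝ) * κ + (a : ℝ) * g)) / ((b : ℝ) * κ + (a : ℝ) * g))
      ≤ (x ^ 2 + (1 - x) * κ) * g := by
  have ha0 : (0 : ℝ) < (a : ℝ) := by exact_mod_cast Nat.lt_of_lt_of_le Nat.zero_lt_one ha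
  have hb0 : (0 : ℝ) < (b : ℝ) := by exact_mod_cast Nat.lt_of_lt_of_le Nat.zero_lt_one hb
  have hg0 : 0 < g := lt_of_lt_of_le hx0 hxg
  have hgam : 0 < x ^ 2 + (1 - x) * κ := by nlinarith [mul_pos (sub_pos.2 hx1) hk0, pow_pos hx0 2]
  have hgam1 : x ^ 2 + (1 - x) * κ < 1 := by nlinarith [mul_lt_mul_of_pos_left hkx (sub_pos.2 hx1)]
  have hT0 : 0 < (b : ℝ) * κ + (a : ℝ) * g := by nlinarith [mul_pos hb0 hk0, mul_pos ha0 hg0]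
  have hsT : (b : ℝ) * κ + (a : ℝ) * g < (b : ℝ) + (a : ℝ) := by
    nlinarith [mul_pos hb0 (sub_pos.2 (hkx.trans hx1)), mul_nonneg ha0.le (sub_nonneg.2 hg1)]
  have hbaj : b + a ≤ j'' := by omega
  have hH1n : x * (a : ℝ) ≤ (b : ℝ) * κ + (a : ℝ) * g - 2 * (b : ℝ) := by have h' := hH1; push_cast at h'; linarith
  have hH0n : x * ((a : ℝ) + (b : ℝ)) ≤ (b : ℝ) * κ + (a : ℝ) * g := by have h' := hH0; push_cast at h'; linarith
  rw [usage_eq_heavy' x _ j'' b (b + a) hx0 hx1 hbaj h2b (by push_cast; linarith) hH1,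
    usage0_eq_heavy x _ j'' (b + a) hx0 hx1 hbaj hT0 (by push_cast; linarith) hH0]
  push_cast
  have hd1 : (0:ℝ) < (b : ℝ) + ((b : ℝ) + (a : ℝ)) - ((b : ℝ) * κ + (a : ℝ) * g) := by linarith
  have hd0 : (0:ℝ) < ((b : ℝ) + (a : ℝ)) - ((b : ℝ) * κ + (a : ℝ) * g) := by linarith
  have hn1 : (0:ℝ) ≤ x ^ 2 * (a : ℝ) + (1 - x) * ((b : ℝ) * κ + (a : ℝ) * g - 2 * (b : ℝ)) := by
    nlinarith [mul_nonneg (pow_nonneg hx0.le 2) ha0.le, mul_nonneg (sub_nonneg.2 hx1.le) (sub_nonneg.2 h2b.le)]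
  have key := LightTwoBlobCert.poly_B3 x κ g a b ha0.le hb0.le (by linarith) (by linarith) (by linarith [hgam.le]) (by linarith) (by linarith) hx0.le
  rw [div_mul_eq_mul_div, sub_div' hT0.ne', div_mul_div_comm, div_add_div _ _ hd1.ne' (mul_ne_zero hd0.ne' hT0.ne'),
    div_le_iff₀ (mul_pos hd1 (mul_pos hd0 hT0))]
  linarith [mul_nonneg hb0.le (mul_nonneg hT0.le (key))]

/-- **top inequality, cell B4** (c>=a, light, light). [this work] -/
theorem top_B4 (x κ g : ℝ) (a b j'' : ℕ) (hx0 : 0 < x) (hx1 : x < 1) (hk0 : 0 < κ) (hkx : κ < x) (hxg : x ≤ g)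
    (hg1 : g ≤ 1) (ha : 1 ≤ a) (hb : 1 ≤ b) (hj : a + b ≤ j'') (h2b : 2 * (b : ℝ) < (b : ℝ) * κ + (a : ℝ) * g)
    (hTa : (a : ℝ) ≤ ((b : ℝ) * κ + (a : ℝ) * g)) (hL1 : ((b : ℝ) * κ + (a : ℝ) * g) - 2 * (b : ℝ) ≤ x * (((b + a : ℕ) : ℝ) - (b : ℝ))) (hL0 : ((b : ℝ) * κ + (a : ℝ) * g) ≤ x * ((b + a : ℕ) : ℝ)) :
    usage x ((b : ℝ) * κ + (a : ℝ) * g) j'' b (b + a) * ((x ^ 2 + (1 - x) * κ) * (1 - g))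
      + usage x ((b : ℝ) * κ + (a : ℝ) * g) j'' 0 (b + a) * ((1 - (x ^ 2 + (1 - x) * κ)) * (1 - g) - 0)
      ≤ (x ^ 2 + (1 - x) * κ) * g := by
  have ha0 : (0 : ℝ) < (a : ℝ) := by exact_mod_cast Nat.lt_of_lt_of_le Nat.zero_lt_one ha
  have hb0 : (0 : ℝ) < (b : ℝ) := by exact_mod_cast Nat.lt_of_lt_of_le Nat.zero_lt_one hb
  have hg0 : 0 < g := lt_of_lt_of_le hx0 hxg
  have hgam : 0 < x ^ 2 + (1 - x) * κ := by nlinarith [mul_pos (sub_pos.2 hx1) hk0, pow_pos hx0 2]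
  have hgam1 : x ^ 2 + (1 - x) * κ < 1 := by nlinarith [mul_lt_mul_of_pos_left hkx (sub_pos.2 hx1)]
  have hT0 : 0 < (b : ℝ) * κ + (a : ℝ) * g := by nlinarith [mul_pos hb0 hk0, mul_pos ha0 hg0]
  have hsT : (b : ℝ) * κ + (a : ℝ) * g < (b : ℝ) + (a : ℝ) := by
    nlinarith [mul_pos hb0 (sub_pos.2 (hkx.trans hx1)), mul_nonneg ha0.le (sub_nonneg.2 hg1)]
  have hbaj : b + a ≤ j'' := by omega
  have hL1n : (b : ℝ) * κ + (a : ℝ) * g - 2 * (b : ℝ) ≤ x * (a : ℝ) := by have h' := hL1; push_cast at h'; linarith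
  have hL0n : (b : ℝ) * κ + (a : ℝ) * g ≤ x * ((a : ℝ) + (b : ℝ)) := by have h' := hL0; push_cast at h'; linarith
  rw [usage_eq_light' x _ j'' b (b + a) hx0 hx1 hbaj h2b (by push_cast; linarith) hL1,
    usage0_eq_light x _ j'' (b + a) hx0 hx1 hbaj hT0 (by push_cast; linarith) hL0]
  push_cast
  have hd1 : (0:ℝ) < (1 - x) * ((1 - x) * (b : ℝ) + (1 + x) * ((b : ℝ) + (a : ℝ)) - ((b : ℝ) * κ + (a : ℝ) * g)) := by
    apply mul_pos (sub_pos.2 hx1); nlinarith [mul_nonneg hx0.le (by linarith : (0:ℝ) ≤ (b : ℝ) + (a : ℝ))]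
  have hd0 : (0:ℝ) < (1 - x) * ((1 + x) * ((b : ℝ) + (a : ℝ)) - ((b : ℝ) * κ + (a : ℝ) * g)) := by
    apply mul_pos (sub_pos.2 hx1); nlinarith [mul_nonneg hx0.le (by linarith : (0:ℝ) ≤ (b : ℝ) + (a : ℝ))]
  have hn1 : (0:ℝ) ≤ x ^ 2 * (a : ℝ) + (1 - x) * ((b : ℝ) * κ + (a : ℝ) * g - 2 * (b : ℝ)) := by
    nlinarith [mul_nonneg (pow_nonneg hx0.le 2) ha0.le, mul_nonneg (sub_nonneg.2 hx1.le) (sub_nonneg.2 h2b.le)]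
  have key := LightTwoBlobCert.poly_B4 x κ g a b hb0.le hx0.le (by linarith) hk0.le (by linarith) (by linarith) (by linarith) (by linarith [hgam.le]) (by linarith) ha0.le (by linarith [hTa]) (by linarith [h2b]) (by linarith [hL1n]) (by linarith [hL0n]) (by linarith [hT0.le]) (by linarith [hd1.le]) (by linarith [hd0.le]) (by linarith [hsT]) (by linarith [hn1])
  rw [sub_zero, div_mul_eq_mul_div, div_mul_eq_mul_div, div_add_div _ _ hd1.ne' hd0.ne', div_le_iff₀ (mul_pos hd1 hd0)]
  linarith [mul_nonneg (sub_nonneg.2 hx1.le) (key)]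

/-- **top inequality, cell B5** (c>=a, light, heavy). [this work] -/
theorem top_B5 (x κ g : ℝ) (a b j'' : ℕ) (hx0 : 0 < x) (hx1 : x < 1) (hk0 : 0 < κ) (hkx : κ < x) (hxg : x ≤ g)
    (hg1 : g ≤ 1) (ha : 1 ≤ a) (hb : 1 ≤ b) (hj : a + b ≤ j'') (h2b : 2 * (b : ℝ) < (b : ℝ) * κ + (a : ℝ) * g)
    (hTa : (a : ℝ) ≤ ((b : ℝ) * κ + (a : ℝ) * g)) (hL1 : ((b : ℝ) * κ + (a : ℝ) * g) - 2 * (b : ℝ) ≤ x * (((b + a : ℕ) : ℝ) - (b : ℝ))) (hH0 : x * ((b + a : ℕ) : ℝ) ≤ ((b : ℝ) * κ + (a : ℝ) * g)) :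
    usage x ((b : ℝ) * κ + (a : ℝ) * g) j'' b (b + a) * ((x ^ 2 + (1 - x) * κ) * (1 - g))
      + usage x ((b : ℝ) * κ + (a : ℝ) * g) j'' 0 (b + a) * ((1 - (x ^ 2 + (1 - x) * κ)) * (1 - g) - 0)
      ≤ (x ^ 2 + (1 - x) * κ) * g := by
  have ha0 : (0 : ℝ) < (a : ℝ) := by exact_mod_cast Nat.lt_of_lt_of_le Nat.zero_lt_one ha
  have hb0 : (0 : ℝ) < (b : ℝ) := by exact_mod_cast Nat.lt_of_lt_of_le Nat.zero_lt_one hb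
  have hg0 : 0 < g := lt_of_lt_of_le hx0 hxg
  have hgam : 0 < x ^ 2 + (1 - x) * κ := by nlinarith [mul_pos (sub_pos.2 hx1) hk0, pow_pos hx0 2]
  have hgam1 : x ^ 2 + (1 - x) * κ < 1 := by nlinarith [mul_lt_mul_of_pos_left hkx (sub_pos.2 hx1)]
  have hT0 : 0 < (b : ℝ) * κ + (a : ℝ) * g := by nlinarith [mul_pos hb0 hk0, mul_pos ha0 hg0]
  have hsT : (b : ℝ) * κ + (a : ℝ) * g < (b : ℝ) + (a : ℝ) := by
    nlinarith [mul_pos hb0 (sub_pos.2 (hkx.trans hx1)), mul_nonneg ha0.le (sub_nonneg.2 hg1)]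
  have hbaj : b + a ≤ j'' := by omega
  have hL1n : (b : ℝ) * κ + (a : ℝ) * g - 2 * (b : ℝ) ≤ x * (a : ℝ) := by have h' := hL1; push_cast at h'; linarith
  have hH0n : x * ((a : ℝ) + (b : ℝ)) ≤ (b : ℝ) * κ + (a : ℝ) * g := by have h' := hH0; push_cast at h'; linarith
  rw [usage_eq_light' x _ j'' b (b + a) hx0 hx1 hbaj h2b (by push_cast; linarith) hL1,
    usage0_eq_heavy x _ j'' (b + a) hx0 hx1 hbaj hT0 (by push_cast; linarith) hH0]
  push_cast
  have hd1 : (0:ℝ) < (1 - x) * ((1 - x) * (b : ℝ) + (1 + x) * ((b : ℝ) + (a : ℝ)) - ((b : ℝ) * κ + (a : ℝ) * g)) := by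
    apply mul_pos (sub_pos.2 hx1); nlinarith [mul_nonneg hx0.le (by linarith : (0:ℝ) ≤ (b : ℝ) + (a : ℝ))]
  have hd0 : (0:ℝ) < ((b : ℝ) + (a : ℝ)) - ((b : ℝ) * κ + (a : ℝ) * g) := by linarith
  have hn1 : (0:ℝ) ≤ x ^ 2 * (a : ℝ) + (1 - x) * ((b : ℝ) * κ + (a : ℝ) * g - 2 * (b : ℝ)) := by
    nlinarith [mul_nonneg (pow_nonneg hx0.le 2) ha0.le, mul_nonneg (sub_nonneg.2 hx1.le) (sub_nonneg.2 h2b.le)]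
  have key := LightTwoBlobCert.poly_B5 x κ g a b hb0.le hx0.le (by linarith) (by linarith) (by linarith) (by linarith) (by linarith [hgam.le]) (by linarith) ha0.le (by linarith [hTa]) (by linarith [h2b]) (by linarith [hL1n]) (by linarith [hH0n]) (by linarith [hd1.le])
  rw [sub_zero, div_mul_eq_mul_div, div_mul_eq_mul_div, div_add_div _ _ hd1.ne' hd0.ne', div_le_iff₀ (mul_pos hd1 hd0)]
  linarith [key]

/-- **top inequality, cell B6** (c>=a, heavy, heavy). [this work] -/
theorem top_B6 (x κ g : ℝ) (a b j'' : ℕ) (hx0 : 0 < x) (hx1 : x < 1) (hk0 : 0 < κ) (hkx : κ < x) (hxg : x ≤ g)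
    (hg1 : g ≤ 1) (ha : 1 ≤ a) (hb : 1 ≤ b) (hj : a + b ≤ j'') (h2b : 2 * (b : ℝ) < (b : ℝ) * κ + (a : ℝ) * g)
    (hTa : (a : ℝ) ≤ ((b : ℝ) * κ + (a : ℝ) * g)) (hH1 : x * (((b + a : ℕ) : ℝ) - (b : ℝ)) ≤ ((b : ℝ) * κ + (a : ℝ) * g) - 2 * (b : ℝ)) (hH0 : x * ((b + a : ℕ) : ℝ) ≤ ((b : ℝ) * κ + (a : ℝ) * g)) :
    usage x ((b : ℝ) * κ + (a : ℝ) * g) j'' b (b + a) * ((x ^ 2 + (1 - x) * κ) * (1 - g))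
      + usage x ((b : ℝ) * κ + (a : ℝ) * g) j'' 0 (b + a) * ((1 - (x ^ 2 + (1 - x) * κ)) * (1 - g) - 0)
      ≤ (x ^ 2 + (1 - x) * κ) * g := by
  have ha0 : (0 : ℝ) < (a : ℝ) := by exact_mod_cast Nat.lt_of_lt_of_le Nat.zero_lt_one ha
  have hb0 : (0 : ℝ) < (b : ℝ) := by exact_mod_cast Nat.lt_of_lt_of_le Nat.zero_lt_one hb
  have hg0 : 0 < g := lt_of_lt_of_le hx0 hxg
  have hgam : 0 < x ^ 2 + (1 - x) * κ := by nlinarith [mul_pos (sub_pos.2 hx1) hk0, pow_pos hx0 2]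
  have hgam1 : x ^ 2 + (1 - x) * κ < 1 := by nlinarith [mul_lt_mul_of_pos_left hkx (sub_pos.2 hx1)]
  have hT0 : 0 < (b : ℝ) * κ + (a : ℝ) * g := by nlinarith [mul_pos hb0 hk0, mul_pos ha0 hg0]
  have hsT : (b : ℝ) * κ + (a : ℝ) * g < (b : ℝ) + (a : ℝ) := by
    nlinarith [mul_pos hb0 (sub_pos.2 (hkx.trans hx1)), mul_nonneg ha0.le (sub_nonneg.2 hg1)]
  have hbaj : b + a ≤ j'' := by omega
  have hH1n : x * (a : ℝ) ≤ (b : ℝ) * κ + (a : ℝ) * g - 2 * (b : ℝ) := by have h' := hH1; push_cast at h'; linarith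
  have hH0n : x * ((a : ℝ) + (b : ℝ)) ≤ (b : ℝ) * κ + (a : ℝ) * g := by have h' := hH0; push_cast at h'; linarith
  rw [usage_eq_heavy' x _ j'' b (b + a) hx0 hx1 hbaj h2b (by push_cast; linarith) hH1,
    usage0_eq_heavy x _ j'' (b + a) hx0 hx1 hbaj hT0 (by push_cast; linarith) hH0]
  push_cast
  have hd1 : (0:ℝ) < (b : ℝ) + ((b : ℝ) + (a : ℝ)) - ((b : ℝ) * κ + (a : ℝ) * g) := by linarith
  have hd0 : (0:ℝ) < ((b : ℝ) + (a : ℝ)) - ((b : ℝ) * κ + (a : ℝ) * g) := by linarith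
  have hn1 : (0:ℝ) ≤ x ^ 2 * (a : ℝ) + (1 - x) * ((b : ℝ) * κ + (a : ℝ) * g - 2 * (b : ℝ)) := by
    nlinarith [mul_nonneg (pow_nonneg hx0.le 2) ha0.le, mul_nonneg (sub_nonneg.2 hx1.le) (sub_nonneg.2 h2b.le)]
  have key := LightTwoBlobCert.poly_B6 x κ g a b hb0.le hx0.le (by linarith) hk0.le (by linarith) (by linarith) (by linarith) (by linarith [hgam.le]) (by linarith) (by linarith [hTa]) (by linarith [h2b]) (by linarith [hT0.le]) (by linarith [hd1.le]) (by linarith [hsT])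
  rw [sub_zero, div_mul_eq_mul_div, div_mul_eq_mul_div, div_add_div _ _ hd1.ne' hd0.ne', div_le_iff₀ (mul_pos hd1 hd0)]
  linarith [key]


end LawDec

end Quant

end Summit.CriticalPhenomena.PercolationContinuityZ3.Theorems
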